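import Summits.ValiantsHypothesis.ValiantsHypothesis.Theorems.LacunarySymmetroidMatrixDescartesKernelDefiniteJunctionGaps

/-!
# Kernel-definite junction, part 4: the three-edge Newton chain ceiling

Helper file for the stub `stub_kernelDefiniteJunction` of the line `junction_ceiling` (crux `MatrixDescartes`,
stmt-ValiantsHypothesis-18050).  Abstract patchwork count for the two-scale family
`f Λ = ∑_{i ≤ I, j ≤ J} F i j Λ^{-j} X^{i+j}` whose coefficient array is supported in the Newton chain
  `(0,0) — (n₀,0) — (I,j₂) — (I,J)`
(support: `i ≤ I`, `j ≤ J`, seam constraint `w i ≤ w n₀ + g j`; `w (I − n₀) = g j₂`; the four vertices nonzero):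
`newton_chain_ceiling` — eventually in `Λ`,
  `#{x > 0 : f Λ (x) = 0} ≤ Z•(E₁) + Z•(E₂) + Z•(E₃)`,
where `Z•` counts positive roots WITH multiplicity and `E₁ = ∑ F i 0 X^i` (bottom edge), `E₂ = ∑_{w i = w n₀ + g j}
F i j X^{i+j}` (seam edge), `E₃ = ∑ F I j X^j` (right edge).  Proof: parts 1–3 (three windows at the scales
`x ~ 1`, `x ~ Λ^{w/(g+w)}`, `x ~ Λ`, three gaps), with `Λ = τ^{g+w}` and a final change of variables back to `Λ`.
For the junction pencil `E₁ = det P̃`, `E₃ = det Q̃`, `E₂` = the seam edge (parts 5–6). [folklore] (Newton polygon count.)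
-/

-- `Summit.ValiantsHypothesis.ValiantsHypothesis.…` is the tree's mandated single-conjunct layout (Sub = Summit).
set_option linter.dupNamespace false
set_option autoImplicit false

namespace Summit.ValiantsHypothesis.ValiantsHypothesis.Theorems.LacunarySymmetroidMatrixDescartes.JunctionCeiling

open Polynomial Filter Set Finset Topology
open scoped BigOperators

/-! ## 1. Small tools: root avoidance, change of variables `Λ = τ^N` -/

/-- Every root `r` of `p` has `|r| + |r|⁻¹` below the root sum `∑ (|r| + |r|⁻¹)`. [folklore] -/
theorem abs_add_inv_le_rootsum (p : ℝ[X]) (r : ℝ) (hr : r ∈ p.roots) :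
    |r| + |r|⁻¹ ≤ (p.roots.map (fun r => |r| + |r|⁻¹)).sum := by
  apply Multiset.single_le_sum
  · intro x hx
    rw [Multiset.mem_map] at hx
    obtain ⟨y, _, rfl⟩ := hx
    positivity
  · exact Multiset.mem_map_of_mem _ hr

/-- A positive point beyond the root sum (or whose inverse is beyond it) is not a root. [folklore] -/
theorem eval_ne_zero_of_rootsum_lt (p : ℝ[X]) (hp : p ≠ 0) (t : ℝ) (ht : 0 < t)
    (h1 : (p.roots.map (fun r => |r| + |r|⁻¹)).sum < t ∨ (p.roots.map (fun r => |r| + |r|⁻¹)).sum < t⁻¹) :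
    p.eval t ≠ 0 := by
  intro h0
  have hr : t ∈ p.roots := (mem_roots hp).2 h0
  have hb := abs_add_inv_le_rootsum p t hr
  rw [abs_of_pos ht] at hb
  have : 0 < t⁻¹ := inv_pos.2 ht
  rcases h1 with h | h <;> linarith

/-- Change of variables `Λ = τ^N`: an eventual statement in `τ` is an eventual statement in `Λ`. [folklore] -/
theorem eventually_atTop_of_pow {P : ℝ → Prop} (N : ℕ) (hN : N ≠ 0)
    (h : ∀ᶠ τ : ℝ in atTop, P (τ ^ N)) : ∀ᶠ Λ : ℝ in atTop, P Λ := by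
  obtain ⟨τ₀, hτ₀⟩ := eventually_atTop.1 h
  refine eventually_atTop.2 ⟨(max τ₀ 0) ^ N, fun Λ hΛ => ?_⟩
  have hΛ0 : 0 ≤ Λ := le_trans (pow_nonneg (le_max_right _ _) _) hΛ
  have key : (Λ ^ ((N : ℝ)⁻¹)) ^ N = Λ := Real.rpow_inv_natCast_pow hΛ0 hN
  rw [← key]
  apply hτ₀
  have h1 : max τ₀ 0 ≤ Λ ^ ((N : ℝ)⁻¹) := by
    apply le_of_pow_le_pow_left₀ hN (Real.rpow_nonneg hΛ0 _)
    rw [key]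
    exact hΛ
  exact (le_max_left _ _).trans h1

/-- positive roots with multiplicity are unchanged by a factor `X^I`. [folklore] -/
theorem countP_roots_X_pow_mul (I : ℕ) (E : ℝ[X]) :
    ((X : ℝ[X]) ^ I * E).roots.countP (fun t => 0 < t) = E.roots.countP (fun t => 0 < t) := by
  by_cases hE : E = 0
  · simp [hE]
  rw [roots_mul (mul_ne_zero (pow_ne_zero _ X_ne_zero) hE), Multiset.countP_add, roots_X_pow]
  have h0 : Multiset.countP (fun t : ℝ => 0 < t) (I • ({0} : Multiset ℝ)) = 0 :=
    Multiset.countP_eq_zero.2 fun x hx h => by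
      have hx' := Multiset.mem_of_mem_nsmul hx
      rw [Multiset.mem_singleton] at hx'
      rw [hx'] at h
      exact lt_irrefl _ h
  rw [h0, zero_add]

/-! ## 2. The edge polynomials of the three windows -/

/-- bottom edge: the `j = 0` terms. [folklore] -/
theorem edgeP_eq (F : ℕ → ℕ → ℝ) (I J N : ℕ) (hN : 0 < N) :
    (∑ i ∈ range (I + 1), ∑ j ∈ range (J + 1), C (if N * j = 0 then F i j else 0) * X ^ (i + j) : ℝ[X]) =
      ∑ i ∈ range (I + 1), C (F i 0) * X ^ i := by
  refine Finset.sum_congr rfl fun i _ => ?_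
  rw [Finset.sum_eq_single_of_mem 0 (by simp)]
  · simp
  · intro j _ hj
    have : N * j ≠ 0 := Nat.mul_ne_zero hN.ne' hj
    simp [this]

/-- seam edge: on the support, `g j + w n₀ − w i = 0` iff `w i = w n₀ + g j`. [folklore] -/
theorem edgeS_eq (F : ℕ → ℕ → ℝ) (I J n₀ g w : ℕ) (hN2 : ∀ i j, F i j ≠ 0 → w * i ≤ w * n₀ + g * j) :
    (∑ i ∈ range (I + 1), ∑ j ∈ range (J + 1),
        C (if g * j + w * n₀ - w * i = 0 then F i j else 0) * X ^ (i + j) : ℝ[X]) =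
      ∑ i ∈ range (I + 1), ∑ j ∈ range (J + 1),
        C (if w * i = w * n₀ + g * j then F i j else 0) * X ^ (i + j) := by
  refine Finset.sum_congr rfl fun i _ => Finset.sum_congr rfl fun j _ => ?_
  by_cases hF : F i j = 0
  · simp [hF]
  · have h := hN2 i j hF
    congr 2
    generalize w * i = A, w * n₀ = B, g * j = D at h ⊢
    by_cases hc : A = B + D
    · rw [if_pos hc, if_pos (by omega)]
    · rw [if_neg hc, if_neg (by omega)]

/-- right edge: the `i = I` terms, `= X^I · E₃`. [folklore] -/
theorem edgeQ_eq (F : ℕ → ℕ → ℝ) (I J N : ℕ) (hN : 0 < N) :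
    (∑ i ∈ range (I + 1), ∑ j ∈ range (J + 1), C (if N * (I - i) = 0 then F i j else 0) * X ^ (i + j) : ℝ[X]) =
      X ^ I * ∑ j ∈ range (J + 1), C (F I j) * X ^ j := by
  rw [Finset.sum_eq_single_of_mem I (by simp)]
  · rw [Finset.mul_sum]
    refine Finset.sum_congr rfl fun j _ => ?_
    simp only [Nat.sub_self, mul_zero, ↓reduceIte, pow_add]
    ring
  · intro i hi hne
    have hlt : i < I := lt_of_le_of_ne (Nat.lt_succ_iff.1 (Finset.mem_range.1 hi)) hne
    have : N * (I - i) ≠ 0 := Nat.mul_ne_zero hN.ne' (by omega)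
    simp [this]

/-- the seam edge has coefficient `F n₀ 0` at `X^{n₀}` (so it is nonzero). [folklore] -/
theorem coeff_edgeS (F : ℕ → ℕ → ℝ) (I J n₀ g w : ℕ) (hw : 0 < w) (hn₀ : n₀ ≤ I) :
    (∑ i ∈ range (I + 1), ∑ j ∈ range (J + 1),
        C (if g * j + w * n₀ - w * i = 0 then F i j else 0) * X ^ (i + j) : ℝ[X]).coeff n₀ = F n₀ 0 := by
  rw [coeff_family]
  rw [Finset.sum_eq_single_of_mem n₀ (Finset.mem_range.2 (Nat.lt_succ_of_le hn₀))]
  · rw [Finset.sum_eq_single_of_mem 0 (by simp)]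
    · simp
    · intro j _ hj
      rw [if_neg (by omega)]
  · intro i _ hi
    refine Finset.sum_eq_zero fun j _ => ?_
    by_cases hij : n₀ = i + j
    · rw [if_pos hij, if_neg]
      have hlt : i < n₀ := by omega
      have : w * i < w * n₀ := Nat.mul_lt_mul_of_pos_left hlt hw
      generalize w * i = A, w * n₀ = B, g * j = D at this ⊢
      omega
    · rw [if_neg hij]

/-- the right edge has coefficient `F I J` at `X^{I+J}` (so it is nonzero). [folklore] -/
theorem coeff_edgeQ (F : ℕ → ℕ → ℝ) (I J N : ℕ) :
    (∑ i ∈ range (I + 1), ∑ j ∈ range (J + 1),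
        C (if N * (I - i) = 0 then F i j else 0) * X ^ (i + j) : ℝ[X]).coeff (I + J) = F I J := by
  rw [coeff_family]
  rw [Finset.sum_eq_single_of_mem I (by simp)]
  · rw [Finset.sum_eq_single_of_mem J (by simp)]
    · simp
    · intro j _ hj
      rw [if_neg (by omega)]
  · intro i hi hne
    have hlt : i < I := lt_of_le_of_ne (Nat.lt_succ_iff.1 (Finset.mem_range.1 hi)) hne
    refine Finset.sum_eq_zero fun j hj => ?_
    have hjJ : j ≤ J := Nat.lt_succ_iff.1 (Finset.mem_range.1 hj)
    rw [if_neg (by omega)]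

/-! ## 3. The Newton chain ceiling -/

/-- **Three-edge Newton chain ceiling** for the two-scale family `f Λ = ∑ F i j Λ^{-j} X^{i+j}`: if the coefficient
array is supported in `i ≤ I`, `j ≤ J`, `w i ≤ w n₀ + g j` (`g, w > 0`, `w (I − n₀) = g j₂`) and the four vertices
`F 0 0, F n₀ 0, F I j₂, F I J` are nonzero, then for all large `Λ` the number of distinct positive roots of `f Λ` is at
most `Z•(E₁) + Z•(E₂) + Z•(E₃)` (positive roots of the three edge polynomials, with multiplicity). [folklore] -/
theorem newton_chain_ceiling (F : ℕ → ℕ → ℝ) (I J n₀ j₂ g w : ℕ) (hg : 0 < g) (hw : 0 < w)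
    (hn₀ : n₀ ≤ I) (hj₂ : j₂ ≤ J) (hC : w * (I - n₀) = g * j₂)
    (hFI : ∀ i j, F i j ≠ 0 → i ≤ I) (hFJ : ∀ i j, F i j ≠ 0 → j ≤ J)
    (hN2 : ∀ i j, F i j ≠ 0 → w * i ≤ w * n₀ + g * j)
    (h00 : F 0 0 ≠ 0) (hn00 : F n₀ 0 ≠ 0) (hI2 : F I j₂ ≠ 0) (hIJ : F I J ≠ 0)
    (f : ℝ → ℝ[X])
    (hf : ∀ Λ, f Λ = ∑ i ∈ range (I + 1), ∑ j ∈ range (J + 1), C (F i j * (Λ⁻¹) ^ j) * X ^ (i + j))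
    (E₁ E₂ E₃ : ℝ[X]) (hE₁ : E₁ = ∑ i ∈ range (I + 1), C (F i 0) * X ^ i)
    (hE₂ : E₂ = ∑ i ∈ range (I + 1), ∑ j ∈ range (J + 1),
      C (if w * i = w * n₀ + g * j then F i j else 0) * X ^ (i + j))
    (hE₃ : E₃ = ∑ j ∈ range (J + 1), C (F I j) * X ^ j) :
    ∀ᶠ Λ : ℝ in atTop, ((f Λ).roots.toFinset.filter (fun t => 0 < t)).card ≤
      E₁.roots.countP (fun t => 0 < t) + E₂.roots.countP (fun t => 0 < t) +
        E₃.roots.countP (fun t => 0 < t) := by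
  classical
  have hNpos : 0 < g + w := by omega
  -- the three edge polynomials in window form
  set EP : ℝ[X] := ∑ i ∈ range (I + 1), ∑ j ∈ range (J + 1),
    C (if (g + w) * j = 0 then F i j else 0) * X ^ (i + j) with hEP
  set ES : ℝ[X] := ∑ i ∈ range (I + 1), ∑ j ∈ range (J + 1),
    C (if g * j + w * n₀ - w * i = 0 then F i j else 0) * X ^ (i + j) with hES
  set EQ : ℝ[X] := ∑ i ∈ range (I + 1), ∑ j ∈ range (J + 1),
    C (if (g + w) * (I - i) = 0 then F i j else 0) * X ^ (i + j) with hEQ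
  have hEP1 : EP = E₁ := by rw [hEP, hE₁]; exact edgeP_eq F I J (g + w) hNpos
  have hES2 : ES = E₂ := by rw [hES, hE₂]; exact edgeS_eq F I J n₀ g w hN2
  have hEQ3 : EQ = X ^ I * E₃ := by rw [hEQ, hE₃]; exact edgeQ_eq F I J (g + w) hNpos
  -- nonvanishing
  have hE₁eval0 : E₁.eval 0 = F 0 0 := by
    rw [hE₁, eval_finsetSum, Finset.sum_eq_single_of_mem 0 (by simp)]
    · simp
    · intro i _ hi
      simp [zero_pow hi]
  have hEP0 : EP ≠ 0 := by
    rw [hEP1]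
    intro h
    rw [h, eval_zero] at hE₁eval0
    exact h00 hE₁eval0.symm
  have hES0 : ES ≠ 0 := by
    intro h
    have hc := coeff_edgeS F I J n₀ g w hw hn₀
    rw [← hES, h, coeff_zero] at hc
    exact hn00 hc.symm
  have hEQ0 : EQ ≠ 0 := by
    intro h
    have hc := coeff_edgeQ F I J (g + w)
    rw [← hEQ, h, coeff_zero] at hc
    exact hIJ hc.symm
  -- the coefficient bound `B` and the smallness scale `θ₀`
  set D : ℝ := 2 * (((I : ℝ) + 1) * ((J : ℝ) + 1)) with hD
  have hDpos : 0 < D := by positivity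
  set B : ℝ := (∑ i ∈ range (I + 1), ∑ j ∈ range (J + 1), |F i j|) + 1 with hB
  have hB1 : 1 ≤ B := by
    have : 0 ≤ ∑ i ∈ range (I + 1), ∑ j ∈ range (J + 1), |F i j| :=
      Finset.sum_nonneg fun i _ => Finset.sum_nonneg fun j _ => abs_nonneg _
    linarith
  have hBpos : 0 < B := by linarith
  have hFB : ∀ i j, |F i j| ≤ B := by
    intro i j
    by_cases hF : F i j = 0
    · rw [hF, abs_zero]; linarith
    · have hi : i ∈ range (I + 1) := Finset.mem_range.2 (Nat.lt_succ_of_le (hFI i j hF))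
      have hj : j ∈ range (J + 1) := Finset.mem_range.2 (Nat.lt_succ_of_le (hFJ i j hF))
      have h1 : |F i j| ≤ ∑ j' ∈ range (J + 1), |F i j'| :=
        Finset.single_le_sum (f := fun j' => |F i j'|) (fun _ _ => abs_nonneg _) hj
      have h2 : (∑ j' ∈ range (J + 1), |F i j'|) ≤ ∑ i' ∈ range (I + 1), ∑ j' ∈ range (J + 1), |F i' j'| :=
        Finset.single_le_sum (f := fun i' => ∑ j' ∈ range (J + 1), |F i' j'|)
          (fun _ _ => Finset.sum_nonneg fun _ _ => abs_nonneg _) hi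
      linarith
  set m₀ : ℝ := min (min |F n₀ 0| |F I j₂|) |F I J| with hm₀
  have hm₀pos : 0 < m₀ := by
    have := abs_pos.2 hn00; have := abs_pos.2 hI2; have := abs_pos.2 hIJ
    positivity
  set θ₀ : ℝ := m₀ / (D * B) with hθ₀
  have hθ₀pos : 0 < θ₀ := by positivity
  have hsmall : ∀ θ : ℝ, 0 ≤ θ → θ ≤ θ₀ → ∀ F₀ : ℝ, m₀ ≤ |F₀| → ∀ i j, |F i j| * θ ≤ |F₀| / D := by
    intro θ hθ0 hθ F₀ hF₀ i j
    calc |F i j| * θ ≤ B * θ₀ := mul_le_mul (hFB i j) hθ hθ0 hBpos.le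
      _ = m₀ / D := by rw [hθ₀]; field_simp
      _ ≤ |F₀| / D := div_le_div_of_nonneg_right hF₀ hDpos.le
  have hm1 : m₀ ≤ |F n₀ 0| := (min_le_left _ _).trans (min_le_left _ _)
  have hm2 : m₀ ≤ |F I j₂| := (min_le_left _ _).trans (min_le_right _ _)
  have hm3 : m₀ ≤ |F I J| := min_le_right _ _
  -- root sums and the window parameters
  set rs₁ : ℝ := (EP.roots.map (fun r => |r| + |r|⁻¹)).sum with hrs₁
  set rs₂ : ℝ := (ES.roots.map (fun r => |r| + |r|⁻¹)).sum with hrs₂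
  set rs₃ : ℝ := (EQ.roots.map (fun r => |r| + |r|⁻¹)).sum with hrs₃
  have hrs_nonneg : ∀ p : ℝ[X], 0 ≤ (p.roots.map (fun r => |r| + |r|⁻¹)).sum := fun p =>
    Multiset.sum_nonneg fun x hx => by
      rw [Multiset.mem_map] at hx
      obtain ⟨y, _, rfl⟩ := hx
      positivity
  have hrs₁0 : 0 ≤ rs₁ := hrs_nonneg EP
  have hrs₂0 : 0 ≤ rs₂ := hrs_nonneg ES
  have hrs₃0 : 0 ≤ rs₃ := hrs_nonneg EQ
  set L : ℝ := max (max 1 θ₀⁻¹) (rs₁ + 1) with hL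
  set σ : ℝ := min (min 1 θ₀) (rs₂ + 1)⁻¹ with hσ
  set ρ : ℝ := max (max 1 θ₀⁻¹) (rs₃ + 1) with hρ
  set R : ℝ := max (max 1 θ₀⁻¹) (rs₃ + 1) with hR
  have hL1 : 1 ≤ L := (le_max_left _ _).trans' (le_max_left _ _)
  have hLθ : L⁻¹ ≤ θ₀ := by
    have : θ₀⁻¹ ≤ L := (le_max_right _ _).trans (le_max_left _ _)
    exact inv_le_of_inv_le₀ hθ₀pos this
  have hLrs : rs₁ < L := by have := le_max_right (max 1 θ₀⁻¹) (rs₁ + 1); linarith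
  have hσpos : 0 < σ := by positivity
  have hσ1 : σ ≤ 1 := (min_le_left _ _).trans (min_le_left _ _)
  have hσθ : σ ≤ θ₀ := (min_le_left _ _).trans (min_le_right _ _)
  have hσrs : rs₂ < σ⁻¹ := by
    have h1 : σ ≤ (rs₂ + 1)⁻¹ := min_le_right _ _
    have h2 : rs₂ + 1 ≤ σ⁻¹ := by
      rw [le_inv_comm₀ (by linarith) hσpos]
      exact h1
    linarith
  have hρ1 : 1 ≤ ρ := (le_max_left _ _).trans' (le_max_left _ _)
  have hρθ : ρ⁻¹ ≤ θ₀ := by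
    have : θ₀⁻¹ ≤ ρ := (le_max_right _ _).trans (le_max_left _ _)
    exact inv_le_of_inv_le₀ hθ₀pos this
  have hρrs : rs₃ < ρ := by have := le_max_right (max 1 θ₀⁻¹) (rs₃ + 1); linarith
  have hR1 : 1 ≤ R := (le_max_left _ _).trans' (le_max_left _ _)
  have hRθ : R⁻¹ ≤ θ₀ := by
    have : θ₀⁻¹ ≤ R := (le_max_right _ _).trans (le_max_left _ _)
    exact inv_le_of_inv_le₀ hθ₀pos this
  have hRrs : rs₃ < R := by have := le_max_right (max 1 θ₀⁻¹) (rs₃ + 1); linarith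
  have hρpos : 0 < ρ := by linarith
  have hRpos : 0 < R := by linarith
  -- the three windows (parts 1–2)
  have hW1 := window_count F I J (g + w) 0 0 (fun _ j => (g + w) * j) (fun i j _ => by ring) f hf EP hEP
    hEP0 0 L (by rw [hEP1, hE₁eval0]; exact h00)
    (by exact eval_ne_zero_of_rootsum_lt EP hEP0 L (by linarith) (Or.inl hLrs))
  have hW2 := window_count F I J (g + w) w (w * n₀) (fun i j => g * j + w * n₀ - w * i)
    (fun i j hF => by
      have h := hN2 i j hF
      have e1 : w * (i + j) = w * i + w * j := mul_add _ _ _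
      have e2 : (g + w) * j = g * j + w * j := add_mul _ _ _
      generalize w * i = A, w * n₀ = B0, g * j = D0, w * j = WJ, w * (i + j) = WS, (g + w) * j = GS
        at h e1 e2 ⊢
      omega)
    f hf ES hES hES0 σ σ⁻¹
    (eval_ne_zero_of_rootsum_lt ES hES0 σ hσpos (Or.inr hσrs))
    (eval_ne_zero_of_rootsum_lt ES hES0 σ⁻¹ (inv_pos.2 hσpos) (Or.inl hσrs))
  have hW3 := window_count F I J (g + w) (g + w) ((g + w) * I) (fun i _ => (g + w) * (I - i))
    (fun i j hF => by
      obtain ⟨k, hk⟩ := Nat.exists_eq_add_of_le (hFI i j hF)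
      rw [hk, Nat.add_sub_cancel_left]
      ring)
    f hf EQ hEQ hEQ0 ρ⁻¹ R
    (eval_ne_zero_of_rootsum_lt EQ hEQ0 ρ⁻¹ (inv_pos.2 hρpos) (Or.inr (by rw [inv_inv]; exact hρrs)))
    (eval_ne_zero_of_rootsum_lt EQ hEQ0 R hRpos (Or.inl hRrs))
  have hτev : ∀ᶠ τ : ℝ in atTop, max 1 θ₀⁻¹ ≤ τ := eventually_ge_atTop _
  -- assemble in `τ`, then change variables
  refine eventually_atTop_of_pow (g + w) hNpos.ne' ?_
  filter_upwards [hW1, hW2, hW3, hτev] with τ hw1 hw2 hw3 hτ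
  have hτ1 : 1 ≤ τ := (le_max_left _ _).trans hτ
  have hτ0 : 0 < τ := by linarith
  have hτθ : τ⁻¹ ≤ θ₀ := inv_le_of_inv_le₀ hθ₀pos ((le_max_right _ _).trans hτ)
  set Λ : ℝ := τ ^ (g + w) with hΛ
  set S : Finset ℝ := (f Λ).roots.toFinset.filter (fun t => 0 < t) with hS
  have hSmem : ∀ x ∈ S, 0 < x ∧ (f Λ).eval x = 0 := by
    intro x hx
    rw [hS, Finset.mem_filter, Multiset.mem_toFinset] at hx
    exact ⟨hx.2, ((mem_roots'.1 hx.1).2)⟩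
  -- no zeros in the gaps
  have hg1 : ∀ x ∈ S, ¬ (L ≤ x ∧ x ≤ σ * τ ^ w) := fun x hx hxw =>
    gap_one F I J n₀ g w hw hn₀ hN2 hn00 f hf τ σ L x hτ1 hσpos hσ1 hL1 hxw
      (fun i j => ⟨hsmall σ hσpos.le hσθ _ hm1 i j, hsmall L⁻¹ (by positivity) hLθ _ hm1 i j,
        hsmall τ⁻¹ (by positivity) hτθ _ hm1 i j⟩) (hSmem x hx).2
  have hg2 : ∀ x ∈ S, ¬ (σ⁻¹ * τ ^ w ≤ x ∧ x ≤ ρ⁻¹ * τ ^ (g + w)) := fun x hx hxw =>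
    gap_two F I J n₀ j₂ g w hw hn₀ hj₂ hC hFI hN2 hI2 f hf τ σ ρ x hτ1 hσpos hσ1 hρ1 hxw
      (fun i j => ⟨hsmall σ hσpos.le hσθ _ hm2 i j, hsmall ρ⁻¹ (by positivity) hρθ _ hm2 i j,
        hsmall τ⁻¹ (by positivity) hτθ _ hm2 i j⟩) (hSmem x hx).2
  have hg3 : ∀ x ∈ S, ¬ (R * τ ^ (g + w) ≤ x) := fun x hx hxw =>
    gap_three F I J g w hFI hFJ hIJ f hf τ R x hτ1 hR1 hxw
      (fun i j => hsmall R⁻¹ (by positivity) hRθ _ hm3 i j) (hSmem x hx).2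
  -- so every positive zero lies in one of the three windows
  set W₁ : Finset ℝ := S.filter (fun x => x ≤ L) with hW₁
  set W₂ : Finset ℝ := S.filter (fun x => σ * τ ^ w ≤ x ∧ x ≤ σ⁻¹ * τ ^ w) with hW₂
  set W₃ : Finset ℝ := S.filter (fun x => ρ⁻¹ * τ ^ (g + w) ≤ x ∧ x ≤ R * τ ^ (g + w)) with hW₃
  have hcover : S ⊆ W₁ ∪ W₂ ∪ W₃ := by
    intro x hx
    have m1 : x ≤ L → x ∈ W₁ := fun h => by rw [hW₁]; exact Finset.mem_filter.2 ⟨hx, h⟩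
    have m2 : σ * τ ^ w ≤ x ∧ x ≤ σ⁻¹ * τ ^ w → x ∈ W₂ := fun h => by
      rw [hW₂]; exact Finset.mem_filter.2 ⟨hx, h⟩
    have m3 : ρ⁻¹ * τ ^ (g + w) ≤ x ∧ x ≤ R * τ ^ (g + w) → x ∈ W₃ := fun h => by
      rw [hW₃]; exact Finset.mem_filter.2 ⟨hx, h⟩
    rw [Finset.mem_union, Finset.mem_union]
    by_cases h1 : x ≤ L
    · exact Or.inl (Or.inl (m1 h1))
    by_cases h2 : x ≤ σ * τ ^ w
    · exact absurd ⟨le_of_not_ge h1, h2⟩ (hg1 x hx)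
    by_cases h3 : x ≤ σ⁻¹ * τ ^ w
    · exact Or.inl (Or.inr (m2 ⟨le_of_not_ge h2, h3⟩))
    by_cases h4 : x ≤ ρ⁻¹ * τ ^ (g + w)
    · exact absurd ⟨le_of_not_ge h3, h4⟩ (hg2 x hx)
    by_cases h5 : x ≤ R * τ ^ (g + w)
    · exact Or.inr (m3 ⟨le_of_not_ge h4, h5⟩)
    · exact absurd (le_of_not_ge h5) (hg3 x hx)
  -- window counts
  have hc1 : W₁.card ≤ Multiset.card (EP.roots.filter (fun t => 0 < t ∧ t < L)) := by
    refine hw1 W₁ fun x hx => ?_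
    rw [hW₁, Finset.mem_filter] at hx
    refine ⟨⟨?_, ?_⟩, (hSmem x hx.1).2⟩
    · rw [pow_zero, one_mul]; exact (hSmem x hx.1).1.le
    · rw [pow_zero, one_mul]; exact hx.2
  have hc2 : W₂.card ≤ Multiset.card (ES.roots.filter (fun t => σ < t ∧ t < σ⁻¹)) := by
    refine hw2 W₂ fun x hx => ?_
    rw [hW₂, Finset.mem_filter] at hx
    refine ⟨⟨?_, ?_⟩, (hSmem x hx.1).2⟩
    · rw [mul_comm]; exact hx.2.1
    · rw [mul_comm]; exact hx.2.2
  have hc3 : W₃.card ≤ Multiset.card (EQ.roots.filter (fun t => ρ⁻¹ < t ∧ t < R)) := by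
    refine hw3 W₃ fun x hx => ?_
    rw [hW₃, Finset.mem_filter] at hx
    refine ⟨⟨?_, ?_⟩, (hSmem x hx.1).2⟩
    · rw [mul_comm]; exact hx.2.1
    · rw [mul_comm]; exact hx.2.2
  -- window counts are at most the positive-root counts with multiplicity
  have hmono : ∀ (p : ℝ[X]) (lo hi : ℝ), 0 ≤ lo →
      Multiset.card (p.roots.filter (fun t => lo < t ∧ t < hi)) ≤ p.roots.countP (fun t => 0 < t) := by
    intro p lo hi hlo
    rw [Multiset.countP_eq_card_filter]
    exact Multiset.card_le_card (Multiset.monotone_filter_right _ fun t ht => hlo.trans_lt ht.1)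
  have h1 := (hc1.trans (hmono EP 0 L le_rfl)); rw [hEP1] at h1
  have h2 := (hc2.trans (hmono ES σ σ⁻¹ hσpos.le)); rw [hES2] at h2
  have h3 := (hc3.trans (hmono EQ ρ⁻¹ R (by positivity))); rw [hEQ3, countP_roots_X_pow_mul] at h3
  calc S.card ≤ (W₁ ∪ W₂ ∪ W₃).card := Finset.card_le_card hcover
    _ ≤ (W₁ ∪ W₂).card + W₃.card := Finset.card_union_le _ _
    _ ≤ W₁.card + W₂.card + W₃.card := by
        have := Finset.card_union_le W₁ W₂
        omega
    _ ≤ _ := by omega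

end Summit.ValiantsHypothesis.ValiantsHypothesis.Theorems.LacunarySymmetroidMatrixDescartes.JunctionCeiling
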